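import Summits.KontsevichZagierPeriods.KontsevichZagierPeriods.Theorems.HermiteRigidityReductionRigidityLandenRatPrimitives
import Summits.KontsevichZagierPeriods.KontsevichZagierPeriods.Theorems.HermiteRigidityIslandComplementBoxLanden

/-!
# `ReductionRigidity` (stmt-KontsevichZagierPeriods-3407), line `Sketch`, stub `stub_landenRat`:
# the Landen certificate at a rational point, II — Landen's identity as a chain of moves

Route `KontsevichZagierPeriods/HermiteRigidity`, crux `ReductionRigidity` (stmt-3407), growth line
`bloch-suslin-rational-dilog` (normalisation of negative arguments for the real Rogers five-term
transfer), worker stub `stub_landenRat`, part 2. For every RATIONAL `0 < a < 1` and the box symbols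
`D(z) = [□², z/(1 − z p₀p₁)]` (value `Li₂(z)`, regular for `z < 1`),

  `2·D(a) + 2·D(a/(a − 1)) + [□², a²/((1 − a p₀)(1 − a p₁))] ∈ KZ.relations`

(values `2Li₂(a)`, `2Li₂(a/(a − 1))`, `log²(1 − a)`: Landen's identity
`Li₂(z) + Li₂(z/(z − 1)) = −½ log²(1 − z)` at `z = a`). This is the rational-parameter version of
`stub_boxLanden` (`a = 1/N`, `HermiteRigidityIslandComplementBoxLanden.lean`), with the same chain:
with the primitives `F₁, F₂, F₃` on `□³` of part I (`stub_landenRatPrimitives`,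
`Fₖ(x, y, t) = Eₖ(x, y, at)`), three Stokes moves in `t` turn the three squares into `[□³, ∂ₜFₖ]`
(the faces `t = 0` vanish), exactness `∂ₜF₁ = ∂ₓG₁`, `∂ₜF₂ = ∂ₓG₂`, `∂ₜF₃ = ∂ₓG₃ + ∂_yH₃` and four
Stokes moves in `x`/`y` leave four face functions on `□²` whose weighted sum is `P − Q` with
`Q(u, t) = P(1 − u, t)`, `P = 2a/((1 − at)(1 − aut))`, and the reflection move (`rfun_chi_reflect`)
kills `[P] − [Q]`. The bookkeeping is done on `χ`-values for an arbitrary additive `χ` killing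
`KZ.relations` (`landenRat_chi`) and then specialised to the quotient map onto the formal period ring
`KZ.FormalPeriodRing = FormalRep ⧸ relations`; the multiplicities `2 • [r]` of the statement are the
integer weights of the `χ`-identity.

References: M. Kontsevich, D. Zagier, *Periods* (2001), §1.2 rules (1)–(3)
[cite: KontsevichZagier2001, §1.2]; J. Ayoub, EMS Newsl. 91 (2014), Def. 10 [cite: Ayoub2014, Def. 10].
No definitions are introduced.
-/

noncomputable section

open MeasureTheory Set MvPolynomial

namespace Summit.KontsevichZagierPeriods.HermiteRigidity.ReductionRigidity

open Literature.NumberTheory.Transcendental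
open Literature.NumberTheory.Transcendental.KZ

/-! ## Bounds on the faces -/

/-- On `□²` (`0 < a < 1`, coordinates `u = x₀`, `t = x₁`) the face denominators are positive:
`1 − aut`, `1 − at`, `1 − at + aut`, `1 − au`, `1 − a + aut`. [folklore] -/
theorem landenRat_face_pos {a : ℚ} (ha₀ : 0 < a) (ha₁ : a < 1) {x : Fin 2 → ℝ} (hx : x ∈ cube 2) :
    0 < 1 - (a : ℝ) * x 0 * x 1 ∧ 0 < 1 - (a : ℝ) * x 1 ∧ 0 < 1 - (a : ℝ) * x 1 + (a : ℝ) * x 0 * x 1 ∧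
      0 < 1 - (a : ℝ) * x 0 ∧ 0 < 1 - (a : ℝ) + (a : ℝ) * x 0 * x 1 := by
  have ha : (0:ℝ) < a := by exact_mod_cast ha₀
  have ha' : (a:ℝ) < 1 := by exact_mod_cast ha₁
  have h := landen_face_bounds hx
  have b01 := mul_le_of_le_one_right ha.le h.2.2.2.2.2
  have b01' := mul_nonneg ha.le h.2.2.2.2.1
  have b0 := mul_le_of_le_one_right ha.le h.2.1
  have b1 := mul_le_of_le_one_right ha.le h.2.2.2.1
  have e01 : (a : ℝ) * x 0 * x 1 = a * (x 0 * x 1) := by ring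
  rw [e01]
  exact ⟨by linarith, by linarith, by linarith, by linarith, by linarith⟩

/-- The two face functions `P = 2a/((1 − at)(1 − aut))` and `Q = 2a/((1 − at)(1 − at + aut))` on `□²`
(coordinates `u = x₀`, `t = x₁`) are regular rational functions there (`0 < a < 1`).
[cite: KontsevichZagier2001, §1.1] -/
theorem exists_landenRat_PQ {a : ℚ} (ha₀ : 0 < a) (ha₁ : a < 1) : ∃ P Q : RFun 2,
    (∀ x ∈ cube 2, P.fn x = 2 * (a : ℝ) / ((1 - (a : ℝ) * x 1) * (1 - (a : ℝ) * x 0 * x 1))) ∧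
    (∀ x ∈ cube 2, Q.fn x =
      2 * (a : ℝ) / ((1 - (a : ℝ) * x 1) * (1 - (a : ℝ) * x 1 + (a : ℝ) * x 0 * x 1))) := by
  have hP : ∀ x ∈ cube 2,
      aeval x ((1 - C a * X 1) * (1 - C a * X 0 * X 1) : MvPolynomial (Fin 2) ℚ) ≠ 0 := by
    intro x hx
    have h := landenRat_face_pos ha₀ ha₁ hx
    simp only [map_sub, map_one, map_mul, aeval_C, aeval_X, eq_ratCast]
    exact mul_ne_zero h.2.1.ne' h.1.ne'
  have hQ : ∀ x ∈ cube 2,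
      aeval x ((1 - C a * X 1) * (1 - C a * X 1 + C a * X 0 * X 1) : MvPolynomial (Fin 2) ℚ) ≠ 0 := by
    intro x hx
    have h := landenRat_face_pos ha₀ ha₁ hx
    simp only [map_sub, map_add, map_one, map_mul, aeval_C, aeval_X, eq_ratCast]
    exact mul_ne_zero h.2.1.ne' h.2.2.1.ne'
  refine ⟨⟨C (2 * a), _, hP⟩, ⟨C (2 * a), _, hQ⟩, fun x _ => ?_, fun x _ => ?_⟩
  · simp only [RFun.fn_apply, map_sub, map_one, map_mul, aeval_C, aeval_X, eq_ratCast]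
    push_cast; ring
  · simp only [RFun.fn_apply, map_sub, map_add, map_one, map_mul, aeval_C, aeval_X, eq_ratCast]
    push_cast; ring

/-! ## The chain of moves, on `χ`-values -/

section Chi

variable {R : Type} [CommRing R] {χ : KZ.FormalRep →+ R}
variable (hrel : ∀ c ∈ KZ.relations, χ c = 0)
include hrel

/-- **Landen's identity at a rational point as a chain of moves, `χ`-form**: for every additive `χ`
killing `KZ.relations` and every rational `0 < a < 1`,
`2χ[□², a/(1 − a xy)] + 2χ[□², b/(1 − b xy)] + χ[□², a²/((1 − ax)(1 − ay))] = 0`, `b = a/(a − 1)`.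
Seven Stokes moves (`RFun.chi_stokesAt`) and one reflection (`rfun_chi_reflect`), with the exactness
identities of `stub_landenRatPrimitives`. [cite: KontsevichZagier2001, §1.2 rules (1)–(3)] -/
theorem landenRat_chi {a : ℚ} (ha₀ : 0 < a) (ha₁ : a < 1) (r₁ r₂ r₃ : IntegralRep 2)
    (hr₁ : r₁.domain = cube 2)
    (hr₁i : EqOn r₁.integrand (fun p => (a : ℝ) / (1 - (a : ℝ) * p 0 * p 1)) (cube 2))
    (hr₂ : r₂.domain = cube 2)
    (hr₂i : EqOn r₂.integrand
      (fun p => ((a / (a - 1) : ℚ) : ℝ) / (1 - ((a / (a - 1) : ℚ) : ℝ) * p 0 * p 1)) (cube 2))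
    (hr₃ : r₃.domain = cube 2)
    (hr₃i : EqOn r₃.integrand
      (fun p => (a : ℝ) ^ 2 / ((1 - (a : ℝ) * p 0) * (1 - (a : ℝ) * p 1))) (cube 2)) :
    2 * χ (KZ.of r₁) + 2 * χ (KZ.of r₂) + χ (KZ.of r₃) = 0 := by
  have ha' : (a:ℝ) < 1 := by exact_mod_cast ha₁
  obtain ⟨F₁, G₁, F₂, G₂, F₃, G₃, H₃, hF₁, hF₁', hG₁, hG₁', hF₂, hF₂', hG₂, hG₂', hF₃, hF₃', hG₃,
    hG₃', hH₃, hH₃'⟩ := stub_landenRatPrimitives a ha₀ ha₁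
  obtain ⟨P, Q, hP, hQ⟩ := exists_landenRat_PQ ha₀ ha₁
  have h1 : (0:ℚ) ≤ 1 ∧ (1:ℚ) ≤ 1 := ⟨zero_le_one, le_rfl⟩
  have h0 : (0:ℚ) ≤ 0 ∧ (0:ℚ) ≤ 1 := ⟨le_rfl, zero_le_one⟩
  have m1 : ∀ (i : Fin 3) {x : Fin 2 → ℝ}, x ∈ cube 2 →
      (Fin.insertNth i (((1:ℚ):ℝ)) x : Fin 3 → ℝ) ∈ cube 3 :=
    fun i x hx => insertNth_mem_cube i (by norm_num) hx
  have m0 : ∀ (i : Fin 3) {x : Fin 2 → ℝ}, x ∈ cube 2 →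
      (Fin.insertNth i (((0:ℚ):ℝ)) x : Fin 3 → ℝ) ∈ cube 3 :=
    fun i x hx => insertNth_mem_cube i (by norm_num) hx
  -- the faces `t = 1` are the three squares
  have tF₁ : ∀ x ∈ cube 2, (F₁.faceAt 2 1 h1).fn x = (a:ℝ) / (1 - (a:ℝ) * x 0 * x 1) := by
    intro x hx
    rw [RFun.fn_faceAt, hF₁ _ (m1 2 hx), insertNth_two_apply_zero, insertNth_two_apply_one,
      insertNth_two_apply_two]
    push_cast; ring
  have tF₂ : ∀ x ∈ cube 2, (F₂.faceAt 2 1 h1).fn x = -(a:ℝ) / (1 - (a:ℝ) + (a:ℝ) * x 0 * x 1) := by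
    intro x hx
    rw [RFun.fn_faceAt, hF₂ _ (m1 2 hx), insertNth_two_apply_zero, insertNth_two_apply_one,
      insertNth_two_apply_two]
    push_cast; ring
  have tF₃ : ∀ x ∈ cube 2, (F₃.faceAt 2 1 h1).fn x =
      (a:ℝ) ^ 2 / ((1 - (a:ℝ) * x 0) * (1 - (a:ℝ) * x 1)) := by
    intro x hx
    rw [RFun.fn_faceAt, hF₃ _ (m1 2 hx), insertNth_two_apply_zero, insertNth_two_apply_one,
      insertNth_two_apply_two]
    push_cast; ring
  -- the faces `t = 0` vanish
  have bF₁ : (F₁.faceAt 2 0 h0).chi χ = 0 := RFun.chi_eq_zero hrel fun x hx => by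
    rw [RFun.fn_faceAt, hF₁ _ (m0 2 hx), insertNth_two_apply_two]; push_cast; ring
  have bF₂ : (F₂.faceAt 2 0 h0).chi χ = 0 := RFun.chi_eq_zero hrel fun x hx => by
    rw [RFun.fn_faceAt, hF₂ _ (m0 2 hx), insertNth_two_apply_two]; push_cast; ring
  have bF₃ : (F₃.faceAt 2 0 h0).chi χ = 0 := RFun.chi_eq_zero hrel fun x hx => by
    rw [RFun.fn_faceAt, hF₃ _ (m0 2 hx), insertNth_two_apply_two]; push_cast; ring
  -- the faces `x = 0` (resp. `y = 0`) of the primitives `Gₖ` (resp. `H₃`) vanish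
  have bG₁ : (G₁.faceAt 0 0 h0).chi χ = 0 := RFun.chi_eq_zero hrel fun x hx => by
    rw [RFun.fn_faceAt, hG₁ _ (m0 0 hx), insertNth_zero_apply_zero]; push_cast; ring
  have bG₂ : (G₂.faceAt 0 0 h0).chi χ = 0 := RFun.chi_eq_zero hrel fun x hx => by
    rw [RFun.fn_faceAt, hG₂ _ (m0 0 hx), insertNth_zero_apply_zero]; push_cast; ring
  have bG₃ : (G₃.faceAt 0 0 h0).chi χ = 0 := RFun.chi_eq_zero hrel fun x hx => by
    rw [RFun.fn_faceAt, hG₃ _ (m0 0 hx), insertNth_zero_apply_zero]; push_cast; ring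
  have bH₃ : (H₃.faceAt 1 0 h0).chi χ = 0 := RFun.chi_eq_zero hrel fun x hx => by
    rw [RFun.fn_faceAt, hH₃ _ (m0 1 hx), insertNth_one_apply_one]; push_cast; ring
  -- the faces `x = 1` / `y = 1`: four functions of `(u, t)` on `□²`
  have tG₁ : ∀ x ∈ cube 2, (G₁.faceAt 0 1 h1).fn x = (a:ℝ) / (1 - (a:ℝ) * x 0 * x 1) := by
    intro x hx
    rw [RFun.fn_faceAt, hG₁ _ (m1 0 hx), insertNth_zero_apply_zero, insertNth_zero_apply_one,
      insertNth_zero_apply_two]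
    push_cast; ring
  have tG₂ : ∀ x ∈ cube 2, (G₂.faceAt 0 1 h1).fn x =
      -(a:ℝ) / ((1 - (a:ℝ) * x 1) * (1 - (a:ℝ) * x 1 + (a:ℝ) * x 0 * x 1)) := by
    intro x hx
    rw [RFun.fn_faceAt, hG₂ _ (m1 0 hx), insertNth_zero_apply_zero, insertNth_zero_apply_one,
      insertNth_zero_apply_two]
    push_cast; ring
  have tG₃ : ∀ x ∈ cube 2, (G₃.faceAt 0 1 h1).fn x =
      (a:ℝ) ^ 2 * x 1 / ((1 - (a:ℝ) * x 1) * (1 - (a:ℝ) * x 0 * x 1)) := by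
    intro x hx
    rw [RFun.fn_faceAt, hG₃ _ (m1 0 hx), insertNth_zero_apply_zero, insertNth_zero_apply_one,
      insertNth_zero_apply_two]
    push_cast; ring
  have tH₃ : ∀ x ∈ cube 2, (H₃.faceAt 1 1 h1).fn x =
      (a:ℝ) ^ 2 * x 1 / ((1 - (a:ℝ) * x 0 * x 1) * (1 - (a:ℝ) * x 1)) := by
    intro x hx
    rw [RFun.fn_faceAt, hH₃ _ (m1 1 hx), insertNth_one_apply_zero, insertNth_one_apply_one,
      insertNth_one_apply_two]
    push_cast; ring
  -- the seven Stokes moves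
  have sF₁ := RFun.chi_stokesAt hrel 2 F₁
  have sF₂ := RFun.chi_stokesAt hrel 2 F₂
  have sF₃ := RFun.chi_stokesAt hrel 2 F₃
  have sG₁ := RFun.chi_stokesAt hrel 0 G₁
  have sG₂ := RFun.chi_stokesAt hrel 0 G₂
  have sG₃ := RFun.chi_stokesAt hrel 0 G₃
  have sH₃ := RFun.chi_stokesAt hrel 1 H₃
  -- exactness: `∂ₜF₁ = ∂ₓG₁`, `∂ₜF₂ = ∂ₓG₂`, `∂ₜF₃ = ∂ₓG₃ + ∂_yH₃`
  have e₁ : (F₁.pd 2).chi χ = (G₁.pd 0).chi χ :=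
    RFun.chi_congr hrel fun p hp => by rw [hF₁' p hp, hG₁' p hp]
  have e₂ : (F₂.pd 2).chi χ = (G₂.pd 0).chi χ :=
    RFun.chi_congr hrel fun p hp => by rw [hF₂' p hp, hG₂' p hp]
  have e₃ : (F₃.pd 2).chi χ = (G₃.pd 0).chi χ + (H₃.pd 1).chi χ := by
    rw [← RFun.chi_add hrel]
    exact RFun.chi_congr hrel fun p hp => by rw [RFun.fn_add hp, hF₃' p hp, hG₃' p hp, hH₃' p hp]
  -- the four face functions, with weights `2, 2, 1, 1`, sum to `P − Q`
  have eU : (((((G₁.faceAt 0 1 h1).add (G₂.faceAt 0 1 h1)).add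
      ((G₁.faceAt 0 1 h1).add (G₂.faceAt 0 1 h1))).add (G₃.faceAt 0 1 h1)).add
      (H₃.faceAt 1 1 h1)).chi χ = (P.sub Q).chi χ := by
    refine RFun.chi_congr hrel fun x hx => ?_
    have h := landenRat_face_pos ha₀ ha₁ hx
    have d1 := h.1.ne'
    have d2 := h.2.1.ne'
    have d3 := h.2.2.1.ne'
    rw [RFun.fn_add hx, RFun.fn_add hx, RFun.fn_add hx, RFun.fn_add hx, RFun.fn_sub hx, tG₁ x hx,
      tG₂ x hx, tG₃ x hx, tH₃ x hx, hP x hx, hQ x hx]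
    field_simp
    ring
  have eU' : (((((G₁.faceAt 0 1 h1).add (G₂.faceAt 0 1 h1)).add
      ((G₁.faceAt 0 1 h1).add (G₂.faceAt 0 1 h1))).add (G₃.faceAt 0 1 h1)).add
      (H₃.faceAt 1 1 h1)).chi χ = (G₁.faceAt 0 1 h1).chi χ + (G₂.faceAt 0 1 h1).chi χ +
        ((G₁.faceAt 0 1 h1).chi χ + (G₂.faceAt 0 1 h1).chi χ) +
        (G₃.faceAt 0 1 h1).chi χ + (H₃.faceAt 1 1 h1).chi χ := by
    simp only [RFun.chi_add hrel]
  have ePQ : (P.sub Q).chi χ = P.chi χ - Q.chi χ := RFun.chi_sub hrel P Q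
  -- the reflection `u ↦ 1 − u` carries `P` to `Q`
  have eQ : Q.chi χ = P.chi χ := by
    refine rfun_chi_reflect hrel 0 P Q fun x hx => ?_
    have h := landen_face_bounds hx
    have hx' : Function.update x 0 (1 - x 0) ∈ cube 2 :=
      KZ.update_mem_cube hx 0 (by linarith) (by linarith)
    rw [hQ x hx, hP _ hx', Function.update_self,
      Function.update_of_ne (show (1 : Fin 2) ≠ 0 by decide)]
    ring
  -- the three squares as faces
  have cr₁ : χ (KZ.of r₁) = (F₁.faceAt 2 1 h1).chi χ :=
    rfun_chi_of_eq hrel _ hr₁ fun x hx => by rw [hr₁i hx, tF₁ x hx]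
  have cr₂ : χ (KZ.of r₂) = (F₂.faceAt 2 1 h1).chi χ := by
    refine rfun_chi_of_eq hrel _ hr₂ fun x hx => ?_
    have d : 1 - (a:ℝ) + (a:ℝ) * x 0 * x 1 ≠ 0 := (landenRat_face_pos ha₀ ha₁ hx).2.2.2.2.ne'
    have d' : (a:ℝ) - 1 ≠ 0 := (sub_neg.2 ha').ne
    rw [hr₂i hx, tF₂ x hx]
    push_cast
    have hB : 1 - (a:ℝ) / ((a:ℝ) - 1) * x 0 * x 1 ≠ 0 := by
      intro h0
      have e : (1 - (a:ℝ) / ((a:ℝ) - 1) * x 0 * x 1) * ((a:ℝ) - 1) = -(1 - a + a * x 0 * x 1) := by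
        field_simp
        ring
      rw [h0, zero_mul] at e
      exact d (neg_eq_zero.1 e.symm)
    rw [div_eq_div_iff hB d]
    field_simp
    ring
  have cr₃ : χ (KZ.of r₃) = (F₃.faceAt 2 1 h1).chi χ :=
    rfun_chi_of_eq hrel _ hr₃ fun x hx => by rw [hr₃i hx, tF₃ x hx]
  linear_combination 2 * cr₁ + 2 * cr₂ + cr₃ - 2 * sF₁ - 2 * sF₂ - sF₃ + 2 * bF₁ + 2 * bF₂ + bF₃ +
    2 * e₁ + 2 * e₂ + e₃ + 2 * sG₁ + 2 * sG₂ + sG₃ + sH₃ - 2 * bG₁ - 2 * bG₂ - bG₃ - bH₃ - eU' +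
    eU + ePQ - eQ

end Chi

/-! ## The registered stub -/

/-- **Stub `stub_landenRat`** (worker stub W2 of crux `ReductionRigidity`, stmt-3407, line `Sketch`,
growth line `bloch-suslin-rational-dilog`): **Landen's identity at every rational point of `(0,1)`
as a chain of moves.** For every rational `0 < x < 1` and any representations `r₁, r₂, r₃` on the
closed square with the printed integrands `x/(1 − x pq)`, `b/(1 − b pq)` (`b = x/(x − 1) < 0`),
`x²/((1 − xp)(1 − xq))` on it, `2[r₁] + 2[r₂] + [r₃] ∈ KZ.relations`
(`2Li₂(x) + 2Li₂(x/(x − 1)) + log²(1 − x) = 0`): `landenRat_chi` for the quotient map onto the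
formal period ring `FormalRep ⧸ relations`. [cite: KontsevichZagier2001, §1.2 rules (1)–(3)] -/
theorem stub_landenRat : ∀ (x : ℚ), 0 < x → x < 1 → ∀ (r₁ r₂ r₃ : IntegralRep 2),
    r₁.domain = cube 2 → EqOn r₁.integrand (fun p => (x : ℝ) / (1 - (x : ℝ) * p 0 * p 1)) (cube 2) →
    r₂.domain = cube 2 →
    EqOn r₂.integrand (fun p => ((x / (x - 1) : ℚ) : ℝ) / (1 - ((x / (x - 1) : ℚ) : ℝ) * p 0 * p 1))
      (cube 2) →
    r₃.domain = cube 2 →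
    EqOn r₃.integrand (fun p => (x : ℝ) ^ 2 / ((1 - (x : ℝ) * p 0) * (1 - (x : ℝ) * p 1))) (cube 2) →
    2 • KZ.of r₁ + 2 • KZ.of r₂ + KZ.of r₃ ∈ KZ.relations := by
  intro a ha₀ ha₁ r₁ r₂ r₃ hr₁ hr₁i hr₂ hr₂i hr₃ hr₃i
  have h := landenRat_chi (χ := (toFormalPeriod.toAddMonoidHom : FormalRep →+ FormalPeriodRing))
    (fun c hc => toFormalPeriod_eq_zero_of_mem hc) ha₀ ha₁ r₁ r₂ r₃ hr₁ hr₁i hr₂ hr₂i hr₃ hr₃i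
  rw [← toFormalPeriod_eq_zero_iff, map_add, map_add, map_nsmul, map_nsmul]
  simpa using h

end Summit.KontsevichZagierPeriods.HermiteRigidity.ReductionRigidity

end
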